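import Summits.HubbardSuperconductivity.HubbardSuperconductivity.Theorems.AnisotropyChordTowerSectorSpace
import Summits.HubbardSuperconductivity.HubbardSuperconductivity.Theorems.AnisotropyChordTowerBridge

/-!
# Route `AnisotropyChord` / H0 rotor rung: the Ising perturbation on a sector and the Perron sector amplitude as the
# Rayleigh–Ritz minimiser of `A_n + (1−Δ) W_n` (work-order v13(c)+(d) of theory seat `hubbard-h0-rotor-theory-1`,
# memo ROTOR-THEORY-11 §161; director CYCLE-12 ruling (A))

* `secW G n` : multiplication by the Ising bond sum `isingW G` on the sector `Sec V n`, symmetric (`secW_symm`) and bounded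
  `|⟨f, W_n f⟩| ≤ (D/8)‖f‖²` (`abs_dot_secW_le`) — hypotheses `hW`, `hWb` of `Tower.bootstrap` / `Tower.eigen_parallel_of_gap`;
* `dot_secForm` : `⟨f, A_n g + η W_n g⟩` as a configuration sum;
* on the torus, for `IsPerronSectorGroundAmplitude L Δ M a` and `n = L²/2 + M`: `perron_secExt` (the amplitude lives on
  `Sec _ n`), `perron_sec_unit`, `perron_sec_nonneg`, **`perron_sec_eigen`** (`A_n ψ + (1−Δ) W_n ψ = (E(M) + D/8) ψ`) and
  **`perron_sec_min`** (the homogeneous Rayleigh–Ritz minimality `hmin` of `Tower.bootstrap`), `perron_sec_energy`.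
-/

set_option linter.dupNamespace false
set_option autoImplicit false

noncomputable section

open Finset Matrix
open Summit.HubbardSuperconductivity.HubbardSuperconductivity.Theorems.AnisotropyChord.InsertionEntropy
open Literature.MathematicalPhysics.QuantumLattice Literature.Probability.LatticeModels

namespace Summit.HubbardSuperconductivity.HubbardSuperconductivity.Theorems.AnisotropyChord.Tower

variable {V : Type} [Fintype V] [DecidableEq V]

section W

variable (G : SimpleGraph V) [DecidableRel G.Adj]

/-- **`W_n`**: multiplication by the Ising bond sum `isingW G` on the amplitudes of the sector with `n` up spins. [folklore] -/
def secW (n : ℕ) : (Sec V n → ℝ) →ₗ[ℝ] (Sec V n → ℝ) where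
  toFun f := fun s => isingW G s.1 * f s
  map_add' f g := by funext s; simp only [Pi.add_apply]; ring
  map_smul' r f := by funext s; simp only [Pi.smul_apply, smul_eq_mul, RingHom.id_apply]; ring

/-- Unfolding `secW`. [folklore] -/
theorem secW_apply {n : ℕ} (f : Sec V n → ℝ) (s : Sec V n) : secW G n f s = isingW G s.1 * f s := rfl

/-- `W_n` is symmetric. [folklore] -/
theorem secW_symm {n : ℕ} (f g : Sec V n → ℝ) : f ⬝ᵥ secW G n g = secW G n f ⬝ᵥ g := by
  unfold dotProduct; simp only [secW_apply]
  exact Finset.sum_congr rfl fun s _ => by ring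

/-- **`W_n` is bounded**: `|⟨f, W_n f⟩| ≤ (D/8)‖f‖²`. [folklore] -/
theorem abs_dot_secW_le {n : ℕ} (f : Sec V n → ℝ) :
    |f ⬝ᵥ secW G n f| ≤ ((1/8 : ℝ) * ∑ x, ∑ y, if G.Adj x y then (1:ℝ) else 0) * (f ⬝ᵥ f) := by
  have h := abs_inner_isingW_le G (secExt n f)
  have e : ∑ σ, isingW G σ * secExt n f σ ^ 2 = f ⬝ᵥ secW G n f := by
    have h1 := sum_secExt_mul f (fun σ => isingW G σ * secExt n f σ)
    simp only [secExt_apply_sec] at h1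
    rw [show (∑ σ, isingW G σ * secExt n f σ ^ 2) = ∑ σ, secExt n f σ * (isingW G σ * secExt n f σ) from
      Finset.sum_congr rfl fun σ _ => by ring, h1]
    rfl
  rw [e, sum_secExt_sq] at h
  exact h

/-- `⟨f, A_n g + η W_n g⟩` as a configuration sum over the extensions. [folklore] -/
theorem dot_secForm {n : ℕ} (f g : Sec V n → ℝ) (η : ℝ) :
    f ⬝ᵥ (secOp G n g + η • secW G n g)
      = ∑ σ, secExt n f σ * (fmOp G (secExt n g) σ + η * (isingW G σ * secExt n g σ)) := by
  rw [sum_secExt_mul]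
  unfold dotProduct
  refine Finset.sum_congr rfl fun s _ => ?_
  simp only [Pi.add_apply, Pi.smul_apply, smul_eq_mul, secOp_apply, secW_apply, secExt_apply_sec]

end W

/-! ### On the torus: the Perron sector amplitude in sector coordinates -/

section Torus

variable {L : ℕ} [NeZero L]

/-- The Perron amplitude of the sector `Sᶻ_tot = M` lives on `Sec _ n`, `n = L²/2 + M`: `ext (res a) = a`. [folklore] -/
theorem perron_secExt {Δ M : ℝ} {a : TensorIndex (TorusSite 2 L) 2 → ℝ} (ha : IsPerronSectorGroundAmplitude L Δ M a)
    {n : ℕ} (hn : (n : ℝ) = (Fintype.card (TorusSite 2 L) : ℝ) / 2 + M) :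
    secExt n (secRes n a) = a :=
  secExt_secRes a fun σ hσ => by rw [perron_support ha σ hσ, hn]

/-- `‖res a‖ = 1`. [folklore] -/
theorem perron_sec_unit {Δ M : ℝ} {a : TensorIndex (TorusSite 2 L) 2 → ℝ} (ha : IsPerronSectorGroundAmplitude L Δ M a)
    {n : ℕ} (hn : (n : ℝ) = (Fintype.card (TorusSite 2 L) : ℝ) / 2 + M) :
    secRes n a ⬝ᵥ secRes n a = 1 := by
  rw [← sum_secExt_sq, perron_secExt ha hn, ha.unit]

/-- `res a ≥ 0`. [folklore] -/
theorem perron_sec_nonneg {Δ M : ℝ} {a : TensorIndex (TorusSite 2 L) 2 → ℝ}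
    (ha : IsPerronSectorGroundAmplitude L Δ M a) (n : ℕ) (s : Sec (TorusSite 2 L) n) : 0 ≤ secRes n a s :=
  ha.nonneg s.1

/-- **Eigen-equation in sector coordinates:** `A_n ψ + (1−Δ) W_n ψ = (E(M) + D/8)·ψ` for `ψ = res a`. [folklore] -/
theorem perron_sec_eigen {Δ M : ℝ} {a : TensorIndex (TorusSite 2 L) 2 → ℝ} (ha : IsPerronSectorGroundAmplitude L Δ M a)
    {n : ℕ} (hn : (n : ℝ) = (Fintype.card (TorusSite 2 L) : ℝ) / 2 + M) :
    secOp (torusGraph 2 L) n (secRes n a) + (1 - Δ) • secW (torusGraph 2 L) n (secRes n a)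
      = (lowestEnergyInSector 1 (xxzHamiltonian 1 (torusGraph 2 L) (-1) Δ) M
          + (1/8 : ℝ) * ∑ x, ∑ y, if (torusGraph 2 L).Adj x y then (1:ℝ) else 0) • secRes n a := by
  funext s
  simp only [Pi.add_apply, Pi.smul_apply, smul_eq_mul, secOp_apply, secW_apply, perron_secExt ha hn]
  have h := perron_eigen_real ha s.1
  unfold secRes
  linarith

/-- The sector energy of `ψ = res a`: `⟨ψ, A_n ψ + (1−Δ) W_n ψ⟩ = E(M) + D/8`. [folklore] -/
theorem perron_sec_energy {Δ M : ℝ} {a : TensorIndex (TorusSite 2 L) 2 → ℝ} (ha : IsPerronSectorGroundAmplitude L Δ M a)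
    {n : ℕ} (hn : (n : ℝ) = (Fintype.card (TorusSite 2 L) : ℝ) / 2 + M) :
    secRes n a ⬝ᵥ (secOp (torusGraph 2 L) n (secRes n a) + (1 - Δ) • secW (torusGraph 2 L) n (secRes n a))
      = lowestEnergyInSector 1 (xxzHamiltonian 1 (torusGraph 2 L) (-1) Δ) M
          + (1/8 : ℝ) * ∑ x, ∑ y, if (torusGraph 2 L).Adj x y then (1:ℝ) else 0 := by
  rw [perron_sec_eigen ha hn, dotProduct_smul, perron_sec_unit ha hn, smul_eq_mul, mul_one]

/-- **Rayleigh–Ritz minimality in sector coordinates** (hypothesis `hmin` of `Tower.bootstrap`): for `ψ = res a` and every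
`b : Sec _ n → ℝ`, `⟨ψ, A_nψ + (1−Δ)W_nψ⟩·⟨b, b⟩ ≤ ⟨b, A_n b + (1−Δ) W_n b⟩`. [folklore] -/
theorem perron_sec_min {Δ M : ℝ} {a : TensorIndex (TorusSite 2 L) 2 → ℝ} (ha : IsPerronSectorGroundAmplitude L Δ M a)
    {n : ℕ} (hn : (n : ℝ) = (Fintype.card (TorusSite 2 L) : ℝ) / 2 + M) (b : Sec (TorusSite 2 L) n → ℝ) :
    (secRes n a ⬝ᵥ (secOp (torusGraph 2 L) n (secRes n a) + (1 - Δ) • secW (torusGraph 2 L) n (secRes n a)))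
        * (b ⬝ᵥ b)
      ≤ b ⬝ᵥ (secOp (torusGraph 2 L) n b + (1 - Δ) • secW (torusGraph 2 L) n b) := by
  rw [dot_secForm, dot_secForm, perron_secExt ha hn, ← sum_secExt_sq]
  exact perron_rayleigh ha (secExt n b) fun σ hσ => by rw [secExt_support b σ hσ, hn]

/-- At the sector ground energy the form is minimal: `(E(M) + D/8)·⟨b,b⟩ ≤ ⟨b, A_n b + (1−Δ) W_n b⟩` whenever the sector
carries a Perron amplitude. [folklore] -/
theorem perron_sec_min' {Δ M : ℝ} {a : TensorIndex (TorusSite 2 L) 2 → ℝ} (ha : IsPerronSectorGroundAmplitude L Δ M a)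
    {n : ℕ} (hn : (n : ℝ) = (Fintype.card (TorusSite 2 L) : ℝ) / 2 + M) (b : Sec (TorusSite 2 L) n → ℝ) :
    (lowestEnergyInSector 1 (xxzHamiltonian 1 (torusGraph 2 L) (-1) Δ) M
        + (1/8 : ℝ) * ∑ x, ∑ y, if (torusGraph 2 L).Adj x y then (1:ℝ) else 0) * (b ⬝ᵥ b)
      ≤ b ⬝ᵥ (secOp (torusGraph 2 L) n b + (1 - Δ) • secW (torusGraph 2 L) n b) := by
  rw [← perron_sec_energy ha hn]; exact perron_sec_min ha hn b

/-- **At `⟨ψ, A_n ψ⟩ = 0` an amplitude is flat on the torus sector:** if the transposition form vanishes on `ψ = res a`,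
then `a` is constant on the sector (the torus graph is connected, tree `torusGraph_connected_of_proj`). [folklore] -/
theorem sec_const_of_form_zero (a : TensorIndex (TorusSite 2 L) 2 → ℝ) {n : ℕ}
    (h0 : secRes n a ⬝ᵥ secOp (torusGraph 2 L) n (secRes n a) = 0) :
    ∀ s s' : Sec (TorusSite 2 L) n, a s.1 = a s'.1 :=
  secOp_ker_const (torusGraph 2 L) (torusGraph_connected_of_proj 2 L) (secRes n a) (by simpa using h0)

end Torus

end Summit.HubbardSuperconductivity.HubbardSuperconductivity.Theorems.AnisotropyChord.Tower
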